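import Summits.AtomisticToContinuum.Crystallization.Theorems.OverbindingBudgetAffineRadialFrameA

/-!
# The Gram–Schmidt frame of a far window and the exact far-defect formula — part B of 2 (§4–§7; sequel of `…RadialFrameA`,
same namespace `…OverbindingBudgetAffineRadialFrame`, all FQNs as in the one-file version)

§4 the exact far defect of `X` against `s • frameIso` (`defect_eq`, `norm_sq_defect`, `norm_sq_defect_wPos`); §5 the Gram–Schmidt
data `α, β, γ, δ, ε` in terms of the Gram matrix and of the chart point (`gsα_sub_eq_chart`, `gsγ_eq_chart`, `gsβ_sq_eq_chart`,
`gsδ_mul_gsβ_eq_chart`, `gsε_sq_eq_chart`); §6 nondegeneracy and the pivot bounds `(1−3θ)√3/2 ≤ β`, `(1−3θ)√(2/3) ≤ ε` from the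
near-isometry clause (`gsβ_ge`, `gsε_ge`); §7 the isometry of an admissible far window `windowIso`, its exact defect on every
window point (`norm_sq_windowDefect`), `μ ≤ s` (`pinningScale_le_chartScale`) and ★★ `far_of_defectBound`: the dictionary
obligation `far` REDUCED to the defect inequality `≤ θ'μ` on the Gram ball (the far clause used once, at `Q := windowIso`).
No `sorry`; only `propext`, `Classical.choice`, `Quot.sound`.
-/

noncomputable section

namespace Summit.AtomisticToContinuum.Crystallization.Theorems.OverbindingBudgetAffineRadialFrame

open scoped BigOperators
open Module
open Summit.AtomisticToContinuum.Crystallization.Theorems.OverbindingBudgetAffineFarSmoothSplit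
open Summit.AtomisticToContinuum.Crystallization.Theorems.OverbindingBudgetAffineRadialChart

local notation "E3" => EuclideanSpace ℝ (Fin 3)

/-! ## §4 The exact far-defect formula for a linear map in its own frame -/

section Defect

variable (X : E3 →ₗ[ℝ] E3)

/-- The image triple `aₐ = X bₐ` of the reduced basis. -/
def img (a : Fin 3) : E3 := X (redBasis a)

/-- The GS data of `X`: `α = ⟪a₁, u₀⟫`, `β = ‖p₁‖`, `γ = ⟪a₂, u₀⟫`, `δ = ⟪a₂, u₁⟫`, `ε = ‖p₂‖` (with `s = ‖a₀‖ = chartScale X`). -/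
def gsα : ℝ := inner ℝ (img X 1) (gsU₀ (img X 0))
/-- `β = ‖p₁‖`. -/
def gsβ : ℝ := ‖gsP₁ (img X 0) (img X 1)‖
/-- `γ = ⟪a₂, u₀⟫`. -/
def gsγ : ℝ := inner ℝ (img X 2) (gsU₀ (img X 0))
/-- `δ = ⟪a₂, u₁⟫`. -/
def gsδ : ℝ := inner ℝ (img X 2) (gsU₁ (img X 0) (img X 1))
/-- `ε = ‖p₂‖`. -/
def gsε : ℝ := ‖gsP₂ (img X 0) (img X 1) (img X 2)‖

/-- `‖a₀‖ = chartScale X`. [formal bookkeeping] -/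
theorem norm_img_zero : ‖img X 0‖ = chartScale X := rfl

variable {X}

/-- `X (redVec n)` in the frame of `X`: `(n₀ s + n₁ α + n₂ γ)•u₀ + (n₁ β + n₂ δ)•u₁ + (n₂ ε)•u₂`. [this file] -/
theorem map_redVec_eq_frame (h₀ : img X 0 ≠ 0) (h₁ : gsP₁ (img X 0) (img X 1) ≠ 0)
    (h₂ : gsP₂ (img X 0) (img X 1) (img X 2) ≠ 0) (n : Fin 3 → ℝ) :
    X (redVec n) = (n 0 * chartScale X + n 1 * gsα X + n 2 * gsγ X) • gsU₀ (img X 0) +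
      (n 1 * gsβ X + n 2 * gsδ X) • gsU₁ (img X 0) (img X 1) + (n 2 * gsε X) • gsU₂ (img X 0) (img X 1) (img X 2) := by
  have e0 := gs_expand₀ h₀
  have e1 := gs_expand₁ h₁
  have e2 := gs_expand₂ h₂
  rw [norm_img_zero] at e0
  have hX : X (redVec n) = n 0 • img X 0 + n 1 • img X 1 + n 2 • img X 2 := by
    rw [redVec_eq, map_add, map_add, map_smul, map_smul, map_smul]; rfl
  rw [hX]
  conv_lhs => rw [e0, e1, e2]
  simp only [gsα, gsβ, gsγ, gsδ, gsε]
  module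

/-- ★ THE EXACT FAR DEFECT: with `Q = frameIso` (the frame of `X` over the reference frame) and `s = chartScale X`,
`X (redVec n) − s • Q (redVec n) = [n₁(α − s/2) + n₂γ]•u₀ + [n₁(β − s·√3/2) + n₂δ]•u₁ + [n₂(ε − s·√(2/3))]•u₂` — the pinned
direction `b₀` contributes nothing. [this file] -/
theorem defect_eq (h₀ : img X 0 ≠ 0) (h₁ : gsP₁ (img X 0) (img X 1) ≠ 0)
    (h₂ : gsP₂ (img X 0) (img X 1) (img X 2) ≠ 0) (n : Fin 3 → ℝ) :
    X (redVec n) - chartScale X • frameIso h₀ h₁ h₂ (redVec n) =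
      (n 1 * (gsα X - chartScale X / 2) + n 2 * gsγ X) • gsU₀ (img X 0) +
      (n 1 * (gsβ X - chartScale X * (Real.sqrt 3 / 2)) + n 2 * gsδ X) • gsU₁ (img X 0) (img X 1) +
      (n 2 * (gsε X - chartScale X * Real.sqrt (2 / 3))) • gsU₂ (img X 0) (img X 1) (img X 2) := by
  rw [map_redVec_eq_frame h₀ h₁ h₂ n, frameIso_redVec h₀ h₁ h₂ n]
  module

/-- ★ Its squared norm: the sum of the three squared brackets. [this file] -/
theorem norm_sq_defect (h₀ : img X 0 ≠ 0) (h₁ : gsP₁ (img X 0) (img X 1) ≠ 0)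
    (h₂ : gsP₂ (img X 0) (img X 1) (img X 2) ≠ 0) (n : Fin 3 → ℝ) :
    ‖X (redVec n) - chartScale X • frameIso h₀ h₁ h₂ (redVec n)‖ ^ 2 =
      (n 1 * (gsα X - chartScale X / 2) + n 2 * gsγ X) ^ 2 +
      (n 1 * (gsβ X - chartScale X * (Real.sqrt 3 / 2)) + n 2 * gsδ X) ^ 2 +
      (n 2 * (gsε X - chartScale X * Real.sqrt (2 / 3))) ^ 2 := by
  rw [defect_eq h₀ h₁ h₂ n, norm_sq_combo h₀ h₁ h₂]

/-- The window form: `‖X (wPos w t) − s • Q (wPos w t)‖²` for every window point. [this file] -/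
theorem norm_sq_defect_wPos (h₀ : img X 0 ≠ 0) (h₁ : gsP₁ (img X 0) (img X 1) ≠ 0)
    (h₂ : gsP₂ (img X 0) (img X 1) (img X 2) ≠ 0) (w : Fin 6 → ℤ) (t : ℤ × ℤ × ℤ) :
    ‖X (wPos w t) - chartScale X • frameIso h₀ h₁ h₂ (wPos w t)‖ ^ 2 =
      (wIdx w t 1 * (gsα X - chartScale X / 2) + wIdx w t 2 * gsγ X) ^ 2 +
      (wIdx w t 1 * (gsβ X - chartScale X * (Real.sqrt 3 / 2)) + wIdx w t 2 * gsδ X) ^ 2 +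
      (wIdx w t 2 * (gsε X - chartScale X * Real.sqrt (2 / 3))) ^ 2 := by
  rw [wPos_eq_redVec, norm_sq_defect]

end Defect

/-! ## §5 The Gram–Schmidt data in terms of the Gram matrix (no square roots needed downstream) -/

section GramData

variable {X : E3 →ₗ[ℝ] E3}

/-- `α·s = ⟪X b₁, X b₀⟫ = gramEntry X 1 0`. [this file] -/
theorem gsα_mul_scale (h₀ : img X 0 ≠ 0) : gsα X * chartScale X = gramEntry X 1 0 := by
  have hs : chartScale X ≠ 0 := by rw [← norm_img_zero]; exact norm_ne_zero_iff.2 h₀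
  unfold gsα gsU₀
  rw [real_inner_smul_right, norm_img_zero]
  field_simp
  rfl

/-- `γ·s = ⟪X b₂, X b₀⟫ = gramEntry X 2 0`. [this file] -/
theorem gsγ_mul_scale (h₀ : img X 0 ≠ 0) : gsγ X * chartScale X = gramEntry X 2 0 := by
  have hs : chartScale X ≠ 0 := by rw [← norm_img_zero]; exact norm_ne_zero_iff.2 h₀
  unfold gsγ gsU₀
  rw [real_inner_smul_right, norm_img_zero]
  field_simp
  rfl

/-- `α² + β² = ‖X b₁‖² = gramEntry X 1 1` (Pythagoras in the frame). [this file] -/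
theorem gsα_sq_add_gsβ_sq (h₀ : img X 0 ≠ 0) (h₁ : gsP₁ (img X 0) (img X 1) ≠ 0)
    (h₂ : gsP₂ (img X 0) (img X 1) (img X 2) ≠ 0) : gsα X ^ 2 + gsβ X ^ 2 = gramEntry X 1 1 := by
  have e1 := gs_expand₁ (a₀ := img X 0) (a₁ := img X 1) h₁
  have h := norm_sq_combo h₀ h₁ h₂ (gsα X) (gsβ X) 0
  rw [zero_smul, add_zero] at h
  rw [gramEntry_self, show X (redBasis 1) = img X 1 from rfl]
  conv_rhs => rw [e1]
  rw [show inner ℝ (img X 1) (gsU₀ (img X 0)) = gsα X from rfl, show ‖gsP₁ (img X 0) (img X 1)‖ = gsβ X from rfl, h]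
  ring

/-- `δ·β + α·γ = ⟪X b₂, X b₁⟫ = gramEntry X 2 1`. [this file] -/
theorem gsδ_mul_gsβ (h₁ : gsP₁ (img X 0) (img X 1) ≠ 0) :
    gsδ X * gsβ X + gsα X * gsγ X = gramEntry X 2 1 := by
  have e1 := gs_expand₁ (a₀ := img X 0) (a₁ := img X 1) h₁
  have : gramEntry X 2 1 = inner ℝ (img X 2) (img X 1) := rfl
  rw [this]
  conv_rhs => rw [e1]
  rw [inner_add_right, real_inner_smul_right, real_inner_smul_right]
  unfold gsδ gsβ gsα gsγ
  ring

/-- `γ² + δ² + ε² = ‖X b₂‖² = gramEntry X 2 2` (Pythagoras in the frame). [this file] -/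
theorem gsγ_sq_add (h₀ : img X 0 ≠ 0) (h₁ : gsP₁ (img X 0) (img X 1) ≠ 0)
    (h₂ : gsP₂ (img X 0) (img X 1) (img X 2) ≠ 0) : gsγ X ^ 2 + gsδ X ^ 2 + gsε X ^ 2 = gramEntry X 2 2 := by
  have e2 := gs_expand₂ (a₀ := img X 0) (a₁ := img X 1) (a₂ := img X 2) h₂
  have h := norm_sq_combo h₀ h₁ h₂ (gsγ X) (gsδ X) (gsε X)
  rw [gramEntry_self, show X (redBasis 2) = img X 2 from rfl]
  conv_rhs => rw [e2]
  exact h.symm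

/-- The GS data in CHART units (`x = gramChart X`, `s = chartScale X`): `α − s/2 = s·x₀` and `γ = s·x₁` — the first bracket of
the defect is `s·(n₁x₀ + n₂x₁)`. [this file] -/
theorem gsα_sub_eq_chart (h₀ : img X 0 ≠ 0) : gsα X - chartScale X / 2 = chartScale X * gramChart X 0 := by
  have hs : chartScale X ≠ 0 := by rw [← norm_img_zero]; exact norm_ne_zero_iff.2 h₀
  have h := gsα_mul_scale h₀
  have h10 : gramEntry X 1 0 = gramEntry X 0 1 := gramEntry_comm X 1 0
  have hx : gramChart X 0 = gramEntry X 0 1 / chartScale X ^ 2 - 1 / 2 := rfl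
  have hα : gsα X = gramEntry X 0 1 / chartScale X := by rw [← h10, ← h]; field_simp
  rw [hα, hx]; field_simp

/-- `γ = s·x₁`. [this file] -/
theorem gsγ_eq_chart (h₀ : img X 0 ≠ 0) : gsγ X = chartScale X * gramChart X 1 := by
  have hs : chartScale X ≠ 0 := by rw [← norm_img_zero]; exact norm_ne_zero_iff.2 h₀
  have h := gsγ_mul_scale h₀
  have h20 : gramEntry X 2 0 = gramEntry X 0 2 := gramEntry_comm X 2 0
  have hx : gramChart X 1 = gramEntry X 0 2 / chartScale X ^ 2 := rfl
  have hγ : gsγ X = gramEntry X 0 2 / chartScale X := by rw [← h20, ← h]; field_simp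
  rw [hγ, hx]; field_simp

/-- `β² = s²·(¾ + x₂ − x₀ − x₀²)` (so `β/s = √(G₁₁ − G₁₀²)`, `= √3/2` at the reference). [this file] -/
theorem gsβ_sq_eq_chart (h₀ : img X 0 ≠ 0) (h₁ : gsP₁ (img X 0) (img X 1) ≠ 0)
    (h₂ : gsP₂ (img X 0) (img X 1) (img X 2) ≠ 0) :
    gsβ X ^ 2 = chartScale X ^ 2 * (3 / 4 + gramChart X 2 - gramChart X 0 - gramChart X 0 ^ 2) := by
  have hs : chartScale X ≠ 0 := by rw [← norm_img_zero]; exact norm_ne_zero_iff.2 h₀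
  have h := gsα_sq_add_gsβ_sq h₀ h₁ h₂
  have ha := gsα_sub_eq_chart h₀
  have hx : gramChart X 2 = gramEntry X 1 1 / chartScale X ^ 2 - 1 := rfl
  have hα : gsα X = chartScale X * (1 / 2 + gramChart X 0) := by linarith
  have hM : gramEntry X 1 1 = chartScale X ^ 2 * (1 + gramChart X 2) := by rw [hx]; field_simp; ring
  rw [hα, hM] at h
  linear_combination h

/-- `δ·β = s²·(x₃ − (½ + x₀)·x₁)`. [this file] -/
theorem gsδ_mul_gsβ_eq_chart (h₀ : img X 0 ≠ 0) (h₁ : gsP₁ (img X 0) (img X 1) ≠ 0) :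
    gsδ X * gsβ X = chartScale X ^ 2 * (gramChart X 3 - (1 / 2 + gramChart X 0) * gramChart X 1) := by
  have hs : chartScale X ≠ 0 := by rw [← norm_img_zero]; exact norm_ne_zero_iff.2 h₀
  have h := gsδ_mul_gsβ h₁
  have ha := gsα_sub_eq_chart h₀
  have hg := gsγ_eq_chart h₀
  have h21 : gramEntry X 2 1 = gramEntry X 1 2 := gramEntry_comm X 2 1
  have hx : gramChart X 3 = gramEntry X 1 2 / chartScale X ^ 2 := rfl
  have hα : gsα X = chartScale X * (1 / 2 + gramChart X 0) := by linarith
  have hM : gramEntry X 2 1 = chartScale X ^ 2 * gramChart X 3 := by rw [hx, ← h21]; field_simp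
  rw [hα, hg, hM] at h
  linear_combination h

/-- `γ² + δ² + ε² = s²·(⅔ + x₄)`. [this file] -/
theorem gsε_sq_eq_chart (h₀ : img X 0 ≠ 0) (h₁ : gsP₁ (img X 0) (img X 1) ≠ 0)
    (h₂ : gsP₂ (img X 0) (img X 1) (img X 2) ≠ 0) :
    gsγ X ^ 2 + gsδ X ^ 2 + gsε X ^ 2 = chartScale X ^ 2 * (2 / 3 + gramChart X 4) := by
  have hs : chartScale X ≠ 0 := by rw [← norm_img_zero]; exact norm_ne_zero_iff.2 h₀
  have h := gsγ_sq_add h₀ h₁ h₂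
  have hx : gramChart X 4 = gramEntry X 2 2 / chartScale X ^ 2 - 2 / 3 := rfl
  have hM : gramEntry X 2 2 = chartScale X ^ 2 * (2 / 3 + gramChart X 4) := by rw [hx]; field_simp; ring
  rw [hM] at h
  exact h

end GramData

/-! ## §6 Nondegeneracy and pivot bounds from the near-isometry clause -/

section Pivots

variable {θ : ℝ} {X : E3 →ₗ[ℝ] E3}

/-- `p₁ = X (b₁ − (α/s)•b₀)`: the first GS residual is the image of a reference vector with `e₁`-coordinate `√3/2`. [this file] -/
theorem gsP₁_eq_map (h₀ : img X 0 ≠ 0) :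
    gsP₁ (img X 0) (img X 1) = X (redBasis 1 - (gsα X / chartScale X) • redBasis 0) := by
  have hs : chartScale X ≠ 0 := by rw [← norm_img_zero]; exact norm_ne_zero_iff.2 h₀
  rw [map_sub, map_smul, gsP₁, gsU₀, smul_smul, norm_img_zero, div_eq_mul_inv]
  rfl

/-- `p₂ = X (b₂ − c₀•b₀ − c₁•b₁)` for explicit `c₀, c₁`: the second GS residual is the image of a reference vector with
`e₂`-coordinate `√(2/3)`. [this file] -/
theorem gsP₂_eq_map (h₀ : img X 0 ≠ 0) :
    gsP₂ (img X 0) (img X 1) (img X 2) =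
      X (redBasis 2 - (gsγ X / chartScale X - gsδ X / gsβ X * (gsα X / chartScale X)) • redBasis 0
        - (gsδ X / gsβ X) • redBasis 1) := by
  have hp1 := gsP₁_eq_map (X := X) h₀
  have h : gsP₂ (img X 0) (img X 1) (img X 2) = img X 2 - gsγ X • gsU₀ (img X 0) - gsδ X • gsU₁ (img X 0) (img X 1) := rfl
  rw [h, gsU₁, show ‖gsP₁ (img X 0) (img X 1)‖ = gsβ X from rfl, hp1, gsU₀, norm_img_zero]
  simp only [img, map_sub, map_smul]
  module

/-- A vector of `E3` is at least its coordinate in absolute value. [formal bookkeeping] -/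
private theorem abs_apply_le_norm (v : E3) (i : Fin 3) : |v i| ≤ ‖v‖ := by
  simpa using PiLp.norm_apply_le v i

/-- Under the near-isometry clause with `3θ < 1`: `a₀ = X b₀ ≠ 0`. [this file] -/
theorem img_zero_ne_zero (hθ : 3 * θ < 1) (hQ : ∃ Q : E3 →ₗᵢ[ℝ] E3, ∀ v : E3, ‖X v - Q v‖ ≤ 3 * θ * ‖v‖) :
    img X 0 ≠ 0 := by
  rw [← norm_ne_zero_iff, norm_img_zero]; exact (chartScale_pos_of_near hθ hQ).ne'

/-- ★ FIRST PIVOT BOUND: `(1 − 3θ)·√3/2 ≤ β = ‖p₁‖` — the residual is the image of a vector with `e₁`-coordinate `√3/2`. [this file] -/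
theorem gsβ_ge (hθ : 3 * θ < 1) (hQ : ∃ Q : E3 →ₗᵢ[ℝ] E3, ∀ v : E3, ‖X v - Q v‖ ≤ 3 * θ * ‖v‖) :
    (1 - 3 * θ) * (Real.sqrt 3 / 2) ≤ gsβ X := by
  have h₀ := img_zero_ne_zero hθ hQ
  set v : E3 := redBasis 1 - (gsα X / chartScale X) • redBasis 0 with hv
  have hβ : gsβ X = ‖X v‖ := by rw [gsβ, gsP₁_eq_map h₀]
  have h1 : v 1 = Real.sqrt 3 / 2 := by
    rw [hv, PiLp.sub_apply, PiLp.smul_apply, smul_eq_mul]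
    simp [redBasis]
  have hcoord : Real.sqrt 3 / 2 ≤ ‖v‖ := by
    have := abs_apply_le_norm v 1
    rw [h1, abs_of_nonneg (by positivity)] at this
    exact this
  have hlow := (norm_bounds_of_nearIsometry hQ v).1
  have h1θ : 0 ≤ 1 - 3 * θ := by linarith
  rw [hβ]
  exact (mul_le_mul_of_nonneg_left hcoord h1θ).trans hlow

/-- Hence `p₁ ≠ 0`. [this file] -/
theorem gsP₁_ne_zero (hθ : 3 * θ < 1) (hQ : ∃ Q : E3 →ₗᵢ[ℝ] E3, ∀ v : E3, ‖X v - Q v‖ ≤ 3 * θ * ‖v‖) :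
    gsP₁ (img X 0) (img X 1) ≠ 0 := by
  rw [← norm_ne_zero_iff, show ‖gsP₁ (img X 0) (img X 1)‖ = gsβ X from rfl]
  have h := gsβ_ge hθ hQ
  have : 0 < (1 - 3 * θ) * (Real.sqrt 3 / 2) := by
    have h1θ : 0 < 1 - 3 * θ := by linarith
    positivity
  exact (this.trans_le h).ne'

/-- ★ SECOND PIVOT BOUND: `(1 − 3θ)·√(2/3) ≤ ε = ‖p₂‖` — the residual is the image of a vector with `e₂`-coordinate `√(2/3)`. [this file] -/
theorem gsε_ge (hθ : 3 * θ < 1) (hQ : ∃ Q : E3 →ₗᵢ[ℝ] E3, ∀ v : E3, ‖X v - Q v‖ ≤ 3 * θ * ‖v‖) :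
    (1 - 3 * θ) * Real.sqrt (2 / 3) ≤ gsε X := by
  have h₀ := img_zero_ne_zero hθ hQ
  set v : E3 := redBasis 2 - (gsγ X / chartScale X - gsδ X / gsβ X * (gsα X / chartScale X)) • redBasis 0
    - (gsδ X / gsβ X) • redBasis 1 with hv
  have hε : gsε X = ‖X v‖ := by rw [gsε, gsP₂_eq_map h₀]
  have h2 : v 2 = Real.sqrt (2 / 3) := by
    rw [hv, PiLp.sub_apply, PiLp.sub_apply, PiLp.smul_apply, PiLp.smul_apply, smul_eq_mul, smul_eq_mul]
    simp [redBasis]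
  have hcoord : Real.sqrt (2 / 3) ≤ ‖v‖ := by
    have := abs_apply_le_norm v 2
    rw [h2, abs_of_nonneg (by positivity)] at this
    exact this
  have hlow := (norm_bounds_of_nearIsometry hQ v).1
  have h1θ : 0 ≤ 1 - 3 * θ := by linarith
  rw [hε]
  exact (mul_le_mul_of_nonneg_left hcoord h1θ).trans hlow

/-- Hence `p₂ ≠ 0`. [this file] -/
theorem gsP₂_ne_zero (hθ : 3 * θ < 1) (hQ : ∃ Q : E3 →ₗᵢ[ℝ] E3, ∀ v : E3, ‖X v - Q v‖ ≤ 3 * θ * ‖v‖) :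
    gsP₂ (img X 0) (img X 1) (img X 2) ≠ 0 := by
  rw [← norm_ne_zero_iff, show ‖gsP₂ (img X 0) (img X 1) (img X 2)‖ = gsε X from rfl]
  have h := gsε_ge hθ hQ
  have : 0 < (1 - 3 * θ) * Real.sqrt (2 / 3) := by
    have h1θ : 0 < 1 - 3 * θ := by linarith
    positivity
  exact (this.trans_le h).ne'

end Pivots

/-! ## §7 The frame isometry of an admissible far window and its defect on every window point -/

section Window

variable {θ θ' : ℝ} {w : Fin 6 → ℤ} {X : E3 →ₗ[ℝ] E3}

/-- ★ THE ISOMETRY THE FAR CLAUSE MUST DEFEAT: the frame isometry of `X` for an admissible far window (`3θ < 1`), with no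
nondegeneracy hypotheses left (they follow from the near-isometry clause). -/
def windowIso (hθ : 3 * θ < 1) (hX : FarWindowData θ θ' w X) : E3 →ₗᵢ[ℝ] E3 :=
  frameIso (img_zero_ne_zero hθ hX.2.1) (gsP₁_ne_zero hθ hX.2.1) (gsP₂_ne_zero hθ hX.2.1)

/-- ★★ The exact squared defect of EVERY window point against `s • windowIso`:
`‖X (wPos w t) − s•Q (wPos w t)‖² = (n₁(α − s/2) + n₂γ)² + (n₁(β − s√3/2) + n₂δ)² + (n₂(ε − s√(2/3)))²`, `n = wIdx w t`,
where in chart units `α − s/2 = s·x₀`, `γ = s·x₁` (`gsα_sub_eq_chart`, `gsγ_eq_chart`), `β² = s²(¾ + x₂ − x₀ − x₀²)`,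
`δβ = s²(x₃ − (½+x₀)x₁)`, `γ² + δ² + ε² = s²(⅔ + x₄)` (`gsβ_sq_eq_chart`, `gsδ_mul_gsβ_eq_chart`, `gsε_sq_eq_chart`) and the pivots
are bounded below (`gsβ_ge`, `gsε_ge`).  All three brackets vanish at the reference point `x = 0`; g69 turns this into
`defect ≤ C·s·‖x‖` on `‖x‖ ≤ r₁` and, with `μ ≤ s ≤ μ(1 + c‖x‖)` for the pinning scale, into the excluded radius of `far`. [this file] -/
theorem norm_sq_windowDefect (hθ : 3 * θ < 1) (hX : FarWindowData θ θ' w X) (t : ℤ × ℤ × ℤ) :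
    ‖X (wPos w t) - chartScale X • windowIso hθ hX (wPos w t)‖ ^ 2 =
      (wIdx w t 1 * (gsα X - chartScale X / 2) + wIdx w t 2 * gsγ X) ^ 2 +
      (wIdx w t 1 * (gsβ X - chartScale X * (Real.sqrt 3 / 2)) + wIdx w t 2 * gsδ X) ^ 2 +
      (wIdx w t 2 * (gsε X - chartScale X * Real.sqrt (2 / 3))) ^ 2 :=
  norm_sq_defect_wPos _ _ _ w t

/-- `b₀ = wPos w (0, 1, 0)` is a first-shell vector of EVERY window. [formal bookkeeping] -/
theorem zero_one_zero_mem_firstShellIdx (op om : ℤ) : ((0 : ℤ), (1 : ℤ), (0 : ℤ)) ∈ firstShellIdx op om := by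
  simp [firstShellIdx, centreShell]

/-- ★ The pinning scale is at most the normalising length: `μ ≤ s = ‖X b₀‖` (`b₀ = wPos w (0,1,0)` is first-shell and `μ` is a
lower bound of the 12 first-shell lengths). [this file] -/
theorem pinningScale_le_chartScale {μ : ℝ} (hmin : ∀ t ∈ firstShellIdx (w 3) (-w 2), μ ≤ ‖X (wPos w t)‖) :
    μ ≤ chartScale X := by
  have h := hmin _ (zero_one_zero_mem_firstShellIdx (w 3) (-w 2))
  have e : wPos w ((0 : ℤ), (1 : ℤ), (0 : ℤ)) = redBasis 0 := by
    rw [wPos_eq_redVec, redVec_eq]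
    have : wIdx w ((0 : ℤ), (1 : ℤ), (0 : ℤ)) = ![1, 0, 0] := by
      ext i; fin_cases i <;> simp [wIdx, redIdx, windowLabel]
    rw [this]; simp [redBasis]
  rwa [e] at h

/-- ★★ THE `far` OBLIGATION REDUCED TO A DEFECT INEQUALITY ON THE GRAM BALL: if, for every admissible far window whose chart
point lies in the open Gram ball `‖gramChart X − x₀‖ < r₁`, the frame isometry `windowIso` has ALL 18 two-shell defects at the
pinning scale `≤ θ'μ`, then every admissible far window has `r₁ ≤ ‖gramChart X − x₀‖` — the field `far` of the chart dictionary
(`…RadialChartFit.chartDictionary_of_obligations`, hypothesis `hfar`).  The far clause is used exactly once, at `Q := windowIso`. [this file] -/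
theorem far_of_defectBound (hθ : 3 * θ < 1) {x₀ : EuclideanSpace ℝ (Fin 5)} {r₁ : ℝ}
    (H : ∀ (X : E3 →ₗ[ℝ] E3) (hX : FarWindowData θ θ' w X) (μ : ℝ),
      (∀ t ∈ firstShellIdx (w 3) (-w 2), μ ≤ ‖X (wPos w t)‖) → (∃ t ∈ firstShellIdx (w 3) (-w 2), μ = ‖X (wPos w t)‖) →
      ‖gramChart X - x₀‖ < r₁ →
        ∀ t ∈ twoShellIdx (w 3) (-w 2), ‖X (wPos w t) - μ • windowIso hθ hX (wPos w t)‖ ≤ θ' * μ) :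
    ∀ X : E3 →ₗ[ℝ] E3, FarWindowData θ θ' w X → r₁ ≤ ‖gramChart X - x₀‖ := by
  intro X hX
  by_contra hlt
  rw [not_le] at hlt
  obtain ⟨-, -, μ, hmin, hatt, hfar⟩ := id hX
  obtain ⟨t, ht, hbig⟩ := hfar (windowIso hθ hX)
  have hsmall := H X hX μ hmin hatt hlt t ht
  exact absurd hbig (not_lt.2 hsmall)

end Window


end Summit.AtomisticToContinuum.Crystallization.Theorems.OverbindingBudgetAffineRadialFrame

end
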